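import Summits.Ventures.CertifiedManyBodySolver.Theorems.M3x2EdgeSplitSymReplayBoxCanon

/-! # E4 bridge lemma B3 `canonTermP_agree` — STATEMENT (sorried) + toys (pen hub-lb-sym-plan-1 g4; NOT a proposal).
The load-bearing bridge lemma for sym-ref-1 g1's TABLE kernel (verbatim below from pub `hub-lb-sym-ref-1/g1-packed/PackedCanonKernel.lean`):
for a NORMAL-ORDERED word inside the box `[−12,12]²` the kernel's own `agrees` test against the tree's `canonTermAB` holds AS A THEOREM.
«Normal-ordered» is stated executably as the fixed point `nfWord w = [(1, w)]` (the tree has no separate predicate); this is exactly the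
population the three-way tie TESTED (0/19 246 + 0/2 992 disagreements). Proof route (engine item, ≈ 300–400 l.): B1 `permTab_spec` (PROVED,
`B1_permTab.lean`) → B2 `imageK_spec` (image blocks = codes of `moveWord γ v` translated to the min corner; `sortPar` parity = sign of the leading
term of `nfWord` of the moved word — the insertion-parity recursion of `insL`, cf. sym-ref-1 `PCollect2Sound.lean` 4ec5d0aa) → B3 by unfolding
`canonAB` (lex-min over `anchoredNFsB`, `polyNegEq` zero test) against `canonP`'s running min with the `pos/neg` flags (set of 8 maps equal by B1's σ57). -/

open Summit.Ventures.CertifiedManyBodySolver.Theorems.SymReplay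
open Literature.MathematicalPhysics.QuantumLattice
open Literature.MathematicalPhysics.QuantumLattice.HubbardWave0
open Literature.Probability.LatticeModels

namespace Summit.Ventures.CertifiedManyBodySolver.Cruxes.LowerEdge_ge_m83o100.E4B3

section Kernel
/-! ## sym-ref-1 g1 kernel, verbatim -/

/-- Packed normal-ordered word: creator modes ascending, annihilator modes ascending. -/
structure PW where
  cre : Array ℕ
  ann : Array ℕ
deriving Inhabited

def encSite (x : Site 2) : ℕ := (x 0 + 12).toNat * 25 + (x 1 + 12).toNat
def encMode (ℓ : Letter) : ℕ := 2 * encSite ℓ.x + ℓ.s.val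
def encW (w : Word) : PW :=
  ⟨((w.filter fun ℓ => ℓ.dag).map encMode).toArray, ((w.filter fun ℓ => !ℓ.dag).map encMode).toArray⟩
def decSite (s : ℕ) : Site 2 := mkSite (((s / 25 : ℕ) : ℤ) - 12) (((s % 25 : ℕ) : ℤ) - 12)
def decLetter (m : ℕ) (dag : Bool) : Letter := ⟨decSite (m / 2), ⟨m % 2, Nat.mod_lt _ (by decide)⟩, dag⟩
def decW (p : PW) : Word := (p.cre.toList.map fun m => decLetter m true) ++ (p.ann.toList.map fun m => decLetter m false)

/-- The eight `D₄` maps on box coordinates `(a,b) ∈ [0,24]²` about the box centre. -/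
def d4ab (k a b : ℕ) : ℕ × ℕ :=
  match k with
  | 0 => (a, b)
  | 1 => (24 - b, a)
  | 2 => (24 - a, 24 - b)
  | 3 => (b, 24 - a)
  | 4 => (a, 24 - b)
  | 5 => (b, a)
  | 6 => (24 - a, b)
  | _ => (24 - b, 24 - a)

/-- Eight permutation arrays on the 625 site codes. -/
def permTab : Array (Array ℕ) :=
  (Array.range 8).map fun k => (Array.range 625).map fun s => let ab := d4ab k (s / 25) (s % 25); ab.1 * 25 + ab.2

/-- Insertion sort of a small array, returning the parity (true = odd) of the sorting permutation. -/
def sortPar (a0 : Array ℕ) : Array ℕ × Bool := Id.run do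
  let mut a := a0
  let mut odd := false
  for i in [1:a0.size] do
    let mut j := i
    while j > 0 && a[j-1]! > a[j]! do
      a := a.swapIfInBounds (j-1) j
      odd := !odd
      j := j - 1
  return (a, odd)

/-- Lexicographic `<` on equal-length key arrays. -/
def keyLt (a b : Array ℕ) : Bool := Id.run do
  for i in [0:a.size] do
    if a[i]! < b[i]! then return true
    if a[i]! > b[i]! then return false
  return false

def keyEq (a b : Array ℕ) : Bool := a == b

/-- Image `k` of a packed word: permute sites, anchor at the min corner, re-sort blocks; returns (key = cre'‖ann', cre', ann', odd). -/
def imageK (P : Array ℕ) (w : PW) : Array ℕ × Array ℕ × Bool := Id.run do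
  -- permuted site codes
  let cs := w.cre.map fun m => (P[m / 2]!, m % 2)
  let as := w.ann.map fun m => (P[m / 2]!, m % 2)
  let mut amin := 25
  let mut bmin := 25
  for (s, _) in cs do
    if s / 25 < amin then amin := s / 25
    if s % 25 < bmin then bmin := s % 25
  for (s, _) in as do
    if s / 25 < amin then amin := s / 25
    if s % 25 < bmin then bmin := s % 25
  let sh := amin * 25 + bmin
  let (c1, o1) := sortPar (cs.map fun (s, σ) => 2 * (s - sh) + σ)
  let (a1, o2) := sortPar (as.map fun (s, σ) => 2 * (s - sh) + σ)
  return (c1, a1, o1 != o2)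

/-- Packed box canon of one word: `none` = the class is zero; else (odd-sign?, representative). -/
def canonP (tab : Array (Array ℕ)) (w : PW) : Option (Bool × PW) := Id.run do
  let (c0, a0, o0) := imageK tab[0]! w
  let mut bestKey := c0 ++ a0
  let mut bc := c0
  let mut ba := a0
  let mut pos := !o0
  let mut neg := o0
  for k in [1:8] do
    let (c, a, o) := imageK tab[k]! w
    let key := c ++ a
    if keyLt key bestKey then
      bestKey := key; bc := c; ba := a; pos := !o; neg := o
    else if keyEq key bestKey then
      if o then neg := true else pos := true
  if pos && neg then return none
  return some (neg, ⟨bc, ba⟩)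

/-- Packed `canonTermAB`: coefficient carried through, sign applied. -/
def canonTermP (tab : Array (Array ℕ)) (t : ℚ × PW) : Option (ℚ × PW) :=
  match canonP tab t.2 with
  | none => none
  | some (neg, r) => some ((if neg then -t.1 else t.1), r)

/-- Agreement test of the packed result with the tree's `canonTermAB lo hi` on one term. -/
def agrees (lo hi : ℤ × ℤ) (tab : Array (Array ℕ)) (t : ℚ × Word) : Bool :=
  let tree := canonTermAB lo hi t
  match canonTermP tab (t.1, encW t.2), tree with
  | none, [] => true
  | some (q, r), [(q', w')] => decide (q = q') && wordEq (decW r) w'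
  | _, _ => false
end Kernel

def lo : ℤ × ℤ := ((-12 : ℤ), (-12 : ℤ))
def hi : ℤ × ℤ := ((12 : ℤ), (12 : ℤ))

/-- Executable «normal-ordered» test: `nfWord w` is the single term `(1, w)` (up to `wordEq`). -/
def isSelfNF (w : Word) : Bool :=
  match nfWord w with
  | [t] => t.1 == 1 && wordEq t.2 w
  | _ => false

/-- B3 (load-bearing bridge lemma; body = engine item). -/
theorem canonTermP_agree (q : ℚ) (w : Word) (hnf : nfWord w = [((1 : ℚ), w)]) (hbox : inBox lo hi w = true) :
    agrees lo hi permTab (q, w) = true := by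
  sorry

/-- B3′: the same with the executable hypothesis (what a checker can discharge by evaluation). -/
theorem canonTermP_agree' (q : ℚ) (w : Word) (hnf : isSelfNF w = true) (hbox : inBox lo hi w = true) :
    agrees lo hi permTab (q, w) = true := by
  sorry

/-- Corollary shape the OUTROUTE fact slot consumes: packed zero ⇒ tree zero, packed rep ⇒ tree rep. -/
theorem canonTermAB_eq_nil_of_canonP (q : ℚ) (w : Word) (hnf : nfWord w = [((1 : ℚ), w)]) (hbox : inBox lo hi w = true)
    (hz : canonP permTab (encW w) = none) : canonTermAB lo hi (q, w) = [] := by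
  have h := canonTermP_agree q w hnf hbox
  unfold agrees canonTermP at h
  rw [hz] at h
  simp only at h
  split at h <;> simp_all

/-! ## Toys (native evaluation; the kernel cannot evaluate the Array table cheaply — see B1 file) -/
def w1 : Word := [⟨mkSite 1 0, 0, true⟩, ⟨mkSite 0 (-1), 0, false⟩]
def w2 : Word := [⟨mkSite (-1) 0, 0, true⟩, ⟨mkSite 1 1, 1, true⟩, ⟨mkSite 1 1, 1, false⟩]
def w3 : Word := [⟨mkSite 0 0, 0, true⟩, ⟨mkSite 0 1, 1, true⟩, ⟨mkSite 0 0, 0, false⟩, ⟨mkSite 0 1, 1, false⟩]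
example : (isSelfNF w1 && isSelfNF w2 && isSelfNF w3) = true := by decide +kernel
example : agrees lo hi permTab (1, w1) && agrees lo hi permTab ((-3 : ℚ), w2) && agrees lo hi permTab (2, w3) = true := by native_decide

end Summit.Ventures.CertifiedManyBodySolver.Cruxes.LowerEdge_ge_m83o100.E4B3
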